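import Summits.HubbardSuperconductivity.HubbardSuperconductivity.Theorems.ThermalWedgeTwSourcedCondensationDiscStaircase
import Summits.HubbardSuperconductivity.HubbardSuperconductivity.Theorems.ThermalWedgeTwSourcedInertnessCorrections

/-!
# Route `ThermalWedge`, cruxes `TwSourcedCondensation` (item `stmt-HubbardSuperconductivity-1697`) and
# `TwSourcedInertness` (item `stmt-HubbardSuperconductivity-1696`) from ONE engine statement

`--supports stmt-HubbardSuperconductivity-1697` file of the line lead (continuation seat c1); no
definition, no `sorry`, no named fact. Notation (docstrings only):
`p̃_L(β,U,μ,h) = log Re Z_β(dWaveSourceTorus L U μ h)/(βL²)`,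
`D_L(β,h) := [p̃_L(β,U,h) − p̃_L(β,0,h)] − [p̃_L(β,U,0) − p̃_L(β,0,0)]` (interaction correction to the
sourced gain), `chord_u(β,h) := p̃_L(β/2,u,h) − p̃_L(β,u,h)` (dyadic heat chord).

THE ENGINE STATEMENT `E = (A) ∧ (B)` (a Benfatto–Giuliani–Mastropietro-type one-cutoff comparison,
`U log β ≤ a`, of the weakly repulsive sourced torus with the free sourced torus at general filling
`μ ∈ (−4,0)`; not in print — BGM 2006 Thm 1.1 / Remark 2 treat the two-point function near the band
bottom at `h = 0`):
* (A) two-sided disc slack, free disc constant: `∃ κ > 0 ∀ η > 0 ∃ U₀ a K`: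
  `|D_L(β,h)| ≤ (η log β + K)h²` for `0 < U ≤ U₀`, `1 ≤ β ≤ e^{a/U}`, `μ ∈ [μ₁,μ₂]`, eventually in
  `L`, `|h| ≤ κ/β`;
* (B) heat-chord slack AT ZERO SOURCE: `∀ η > 0 ∃ U₀ a K'`:
  `chord_U(β,0) − chord_0(β,0) ≤ (η log β + K')/β²` for `0 < U ≤ U₀`, `2 ≤ β ≤ e^{a/U}`,
  `μ ∈ [μ₁,μ₂]`, eventually in `L`.

Results (sorry-free):
1. `discStubs_of_engine` — the disc stubs (S_κ), (T_κ) of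
   `ThermalWedgeTwSourcedCondensationDiscStaircase` follow from `E`: (S_κ) is the lower half of (A);
   (T_κ) at a sourced `h`, `|h| ≤ κ/β`, is (B) plus (A) at `β/2` and `β`, by the identity
   `[chord_U − chord_0](β,h) = [chord_U − chord_0](β,0) + D_L(β/2,h) − D_L(β,h)` and `h²β² ≤ 1`;
   for `1 ≤ β < 2` the crude sandwich `|p̃_U − p̃_0| ≤ U` gives `≤ 2U ≤ 8U₀/β²`. So the SOURCED
   thermal stub of the line has no content beyond `h = 0`.
2. `twSourcedCondensation_of_engine : (A) → (B) → TwSourcedCondensation`.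
3. `twSourcedInertness_of_engine : (A) → (B) → TwSourcedInertness` — the upper half of (A) at
   `η = 1` is hypothesis (D) of `twSourcedInertness_of_corrections` (p84477), (B) at `η = 1` its (T).

Sources: G. Benfatto, A. Giuliani, V. Mastropietro, Ann. Henri Poincaré 7 (2006) 809, Thm 1.1,
§2.8, Remark 2 [BenfattoGiulianiMastropietro2006]; D. Ruelle, *Statistical Mechanics* (1969) §2.5
[Ruelle1969]. Tree: `twSourcedCondensation_of_discStubs`, `abs_sourcedPressure_interacting_sub_free_le`,
`twSourcedInertness_of_corrections`, `dWaveSourceTorus_zero`.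
-/

noncomputable section

namespace Summit.HubbardSuperconductivity.HubbardSuperconductivity.Theorems

open Matrix Finset Literature.MathematicalPhysics.QuantumLattice
open Summit.HubbardSuperconductivity.HubbardSuperconductivity.Theses.ThermalWedge

/-! ### 1. The disc stubs from the engine statement -/

/-- **(S_κ), (T_κ) from the engine statement `E = (A) ∧ (B)`.** (S_κ) is the lower half of the
two-sided disc slack (A) (with `κ := min κ_A 1`); (T_κ) at a sourced `h` with `|h| ≤ κ/β` is
(B) at zero source plus (A) at `β/2` and at `β` (`η/3` each), since
`[chord_U − chord_0](β,h) = [chord_U − chord_0](β,0) + D_L(β/2,h) − D_L(β,h)` and `h² ≤ 1/β²`; for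
`1 ≤ β < 2` the crude sandwich `|p̃_U − p̃_0| ≤ U` gives `[chord_U − chord_0](β,h) ≤ 2U ≤ 8U₀/β²`.
[cite: BenfattoGiulianiMastropietro2006, Thm 1.1 and Remark 2] -/
theorem discStubs_of_engine :
    (∀ μ₁ μ₂ : ℝ, -4 < μ₁ → μ₁ ≤ μ₂ → μ₂ < 0 → ∃ κ : ℝ, 0 < κ ∧ ∀ η : ℝ, 0 < η →
      ∃ U₀ a K : ℝ, 0 < U₀ ∧ 0 < a ∧ 0 < K ∧ ∀ U : ℝ, 0 < U → U ≤ U₀ →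
      ∀ β : ℝ, 1 ≤ β → β ≤ Real.exp (a / U) → ∀ μ ∈ Set.Icc μ₁ μ₂, ∃ L₀ : ℕ,
      ∀ (L : ℕ) [NeZero L], L₀ ≤ L → ∀ h : ℝ, |h| ≤ κ / β →
        |(Real.log (Matrix.partitionFn β
            (Literature.MathematicalPhysics.QuantumLattice.dWaveSourceTorus L U μ h)).re /
            (β * (L : ℝ) ^ 2) -
            Real.log (Matrix.partitionFn β
            (Literature.MathematicalPhysics.QuantumLattice.dWaveSourceTorus L 0 μ h)).re /
            (β * (L : ℝ) ^ 2)) -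
          (Real.log (Matrix.partitionFn β
            (Literature.MathematicalPhysics.QuantumLattice.dWaveSourceTorus L U μ 0)).re /
            (β * (L : ℝ) ^ 2) -
            Real.log (Matrix.partitionFn β
            (Literature.MathematicalPhysics.QuantumLattice.dWaveSourceTorus L 0 μ 0)).re /
            (β * (L : ℝ) ^ 2))| ≤
        (η * Real.log β + K) * h ^ 2) →
    (∀ μ₁ μ₂ : ℝ, -4 < μ₁ → μ₁ ≤ μ₂ → μ₂ < 0 → ∀ η : ℝ, 0 < η →
      ∃ U₀ a K' : ℝ, 0 < U₀ ∧ 0 < a ∧ 0 < K' ∧ ∀ U : ℝ, 0 < U → U ≤ U₀ →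
      ∀ β : ℝ, 2 ≤ β → β ≤ Real.exp (a / U) → ∀ μ ∈ Set.Icc μ₁ μ₂, ∃ L₀ : ℕ,
      ∀ (L : ℕ) [NeZero L], L₀ ≤ L →
        (Real.log (Matrix.partitionFn (β / 2)
            (Literature.MathematicalPhysics.QuantumLattice.dWaveSourceTorus L U μ 0)).re /
            (β / 2 * (L : ℝ) ^ 2) -
            Real.log (Matrix.partitionFn β
            (Literature.MathematicalPhysics.QuantumLattice.dWaveSourceTorus L U μ 0)).re /
            (β * (L : ℝ) ^ 2)) -
          (Real.log (Matrix.partitionFn (β / 2)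
            (Literature.MathematicalPhysics.QuantumLattice.dWaveSourceTorus L 0 μ 0)).re /
            (β / 2 * (L : ℝ) ^ 2) -
            Real.log (Matrix.partitionFn β
            (Literature.MathematicalPhysics.QuantumLattice.dWaveSourceTorus L 0 μ 0)).re /
            (β * (L : ℝ) ^ 2)) ≤
        (η * Real.log β + K') / β ^ 2) →
    ∀ μ₁ μ₂ : ℝ, -4 < μ₁ → μ₁ ≤ μ₂ → μ₂ < 0 → ∃ κ : ℝ, 0 < κ ∧ κ ≤ 1 ∧
      (∀ η : ℝ, 0 < η → ∃ U₀ a K : ℝ, 0 < U₀ ∧ 0 < a ∧ 0 < K ∧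
        ∀ U : ℝ, 0 < U → U ≤ U₀ → ∀ β : ℝ, 1 ≤ β → β ≤ Real.exp (a / U) →
        ∀ μ ∈ Set.Icc μ₁ μ₂, ∃ L₀ : ℕ, ∀ (L : ℕ) [NeZero L], L₀ ≤ L → ∀ h : ℝ, |h| ≤ κ / β →
          (Real.log (Matrix.partitionFn β
            (Literature.MathematicalPhysics.QuantumLattice.dWaveSourceTorus L 0 μ h)).re /
            (β * (L : ℝ) ^ 2) -
              Real.log (Matrix.partitionFn β
            (Literature.MathematicalPhysics.QuantumLattice.dWaveSourceTorus L 0 μ 0)).re /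
            (β * (L : ℝ) ^ 2)) -
            (η * Real.log β + K) * h ^ 2 ≤
          Real.log (Matrix.partitionFn β
            (Literature.MathematicalPhysics.QuantumLattice.dWaveSourceTorus L U μ h)).re /
            (β * (L : ℝ) ^ 2) -
            Real.log (Matrix.partitionFn β
            (Literature.MathematicalPhysics.QuantumLattice.dWaveSourceTorus L U μ 0)).re /
            (β * (L : ℝ) ^ 2)) ∧
      (∀ η : ℝ, 0 < η → ∃ U₀ a K' : ℝ, 0 < U₀ ∧ 0 < a ∧ 0 < K' ∧
        ∀ U : ℝ, 0 < U → U ≤ U₀ → ∀ β : ℝ, 1 ≤ β → β ≤ Real.exp (a / U) →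
        ∀ μ ∈ Set.Icc μ₁ μ₂, ∃ L₀ : ℕ, ∀ (L : ℕ) [NeZero L], L₀ ≤ L → ∀ h : ℝ, |h| ≤ κ / β →
          (Real.log (Matrix.partitionFn (β / 2)
            (Literature.MathematicalPhysics.QuantumLattice.dWaveSourceTorus L U μ h)).re /
            (β / 2 * (L : ℝ) ^ 2) -
              Real.log (Matrix.partitionFn β
            (Literature.MathematicalPhysics.QuantumLattice.dWaveSourceTorus L U μ h)).re /
            (β * (L : ℝ) ^ 2)) -
            (Real.log (Matrix.partitionFn (β / 2)
            (Literature.MathematicalPhysics.QuantumLattice.dWaveSourceTorus L 0 μ h)).re /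
            (β / 2 * (L : ℝ) ^ 2) -
              Real.log (Matrix.partitionFn β
            (Literature.MathematicalPhysics.QuantumLattice.dWaveSourceTorus L 0 μ h)).re /
            (β * (L : ℝ) ^ 2)) ≤
          (η * Real.log β + K') / β ^ 2) := by
  intro hA hB μ₁ μ₂ h4 h12 h0
  obtain ⟨κA, hκA, hAη⟩ := hA μ₁ μ₂ h4 h12 h0
  have hBη := hB μ₁ μ₂ h4 h12 h0
  set κ : ℝ := min κA 1 with hκdef
  have hκ : 0 < κ := lt_min hκA one_pos
  have hκ1 : κ ≤ 1 := min_le_right _ _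
  have hκA' : κ ≤ κA := min_le_left _ _
  refine ⟨κ, hκ, hκ1, ?_, ?_⟩
  · -- (S_κ): the lower half of (A)
    intro η hη
    obtain ⟨U₀, a, K, hU₀, ha, hK, hmain⟩ := hAη η hη
    refine ⟨U₀, a, K, hU₀, ha, hK, fun U hU hUU₀ β hβ hβa μ hμ => ?_⟩
    obtain ⟨L₀, hL₀⟩ := hmain U hU hUU₀ β hβ hβa μ hμ
    refine ⟨L₀, fun L _ hL h hh => ?_⟩
    have hβpos : 0 < β := by linarith
    have hhA : |h| ≤ κA / β := hh.trans (div_le_div_of_nonneg_right hκA' hβpos.le)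
    have key := hL₀ L hL h hhA
    rw [abs_le] at key
    linarith [key.1]
  · -- (T_κ): (B) at zero source plus (A) at β/2 and β
    intro η hη
    obtain ⟨U₁, a₁, K₁, hU₁, ha₁, hK₁, hA1⟩ := hAη (η / 3) (by positivity)
    obtain ⟨U₂, a₂, K₂, hU₂, ha₂, hK₂, hB1⟩ := hBη (η / 3) (by positivity)
    refine ⟨min U₁ U₂, min a₁ a₂, K₂ + 2 * K₁ + 8 * U₁, lt_min hU₁ hU₂, lt_min ha₁ ha₂,
      by positivity, fun U hU hUU₀ β hβ hβa μ hμ => ?_⟩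
    have hβpos : 0 < β := by linarith
    have hUU₁ : U ≤ U₁ := hUU₀.trans (min_le_left _ _)
    have hUU₂ : U ≤ U₂ := hUU₀.trans (min_le_right _ _)
    have hβa₁ : β ≤ Real.exp (a₁ / U) := le_exp_div_of_le' hU hβa (min_le_left _ _)
    have hβa₂ : β ≤ Real.exp (a₂ / U) := le_exp_div_of_le' hU hβa (min_le_right _ _)
    have hsq' : ∀ h : ℝ, 0 ≤ h ^ 2 := fun h => sq_nonneg h
    have hlogβ : 0 ≤ Real.log β := Real.log_nonneg hβ
    have hβsq : 0 < β ^ 2 := by positivity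
    by_cases hβ2 : 2 ≤ β
    · -- cold temperatures β ≥ 2: (B) at h = 0 and (A) at β/2, β
      have hβ2pos : 0 < β / 2 := by positivity
      have hb1 : 1 ≤ β / 2 := by linarith
      have hb2 : β / 2 ≤ Real.exp (a₁ / U) := (half_le_self hβpos.le).trans hβa₁
      obtain ⟨LA, hLA⟩ := hA1 U hU hUU₁ β hβ hβa₁ μ hμ
      obtain ⟨LA2, hLA2⟩ := hA1 U hU hUU₁ (β / 2) hb1 hb2 μ hμ
      obtain ⟨LB, hLB⟩ := hB1 U hU hUU₂ β hβ2 hβa₂ μ hμ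
      refine ⟨max LA (max LA2 LB), fun L _ hL h hh => ?_⟩
      have hLA' : LA ≤ L := (le_max_left _ _).trans hL
      have hLA2' : LA2 ≤ L := ((le_max_left _ _).trans (le_max_right _ _)).trans hL
      have hLB' : LB ≤ L := ((le_max_right _ _).trans (le_max_right _ _)).trans hL
      have hsq := hsq' h
      have hhA : |h| ≤ κA / β := hh.trans (div_le_div_of_nonneg_right hκA' hβpos.le)
      have hhA2 : |h| ≤ κA / (β / 2) := by
        refine hhA.trans ?_
        rw [div_le_div_iff_of_pos_left hκA hβpos hβ2pos]
        linarith only [hβpos]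
      -- h² β² ≤ 1 and log(β/2) ≤ log β
      have hh1 : |h| ≤ 1 / β := hh.trans (div_le_div_of_nonneg_right hκ1 hβpos.le)
      have hhb : h ^ 2 * β ^ 2 ≤ 1 := by
        have h9 : |h| * β ≤ 1 := by rwa [le_div_iff₀ hβpos] at hh1
        have h9' : 0 ≤ |h| * β := by positivity
        have := pow_le_pow_left₀ h9' h9 2
        rw [mul_pow, sq_abs, one_pow] at this
        exact this
      have hlog2 : Real.log (β / 2) ≤ Real.log β :=
        Real.log_le_log hβ2pos (half_le_self hβpos.le)
      have ht1 : 0 ≤ η / 3 * Real.log β + K₁ := by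
        have := mul_nonneg (by positivity : (0 : ℝ) ≤ η / 3) hlogβ
        linarith only [this, hK₁]
      have e1 : (η / 3 * Real.log β + K₁) * h ^ 2 * β ^ 2 ≤ η / 3 * Real.log β + K₁ := by
        calc (η / 3 * Real.log β + K₁) * h ^ 2 * β ^ 2
            = (η / 3 * Real.log β + K₁) * (h ^ 2 * β ^ 2) := by ring
          _ ≤ (η / 3 * Real.log β + K₁) * 1 := mul_le_mul_of_nonneg_left hhb ht1
          _ = η / 3 * Real.log β + K₁ := mul_one _
      have e2 : (η / 3 * Real.log (β / 2) + K₁) * h ^ 2 * β ^ 2 ≤ η / 3 * Real.log β + K₁ := by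
        have hfac : η / 3 * Real.log (β / 2) + K₁ ≤ η / 3 * Real.log β + K₁ := by
          have := mul_le_mul_of_nonneg_left hlog2 (by positivity : (0 : ℝ) ≤ η / 3)
          linarith only [this]
        have hmono := mul_le_mul_of_nonneg_right hfac (mul_nonneg hsq hβsq.le)
        calc (η / 3 * Real.log (β / 2) + K₁) * h ^ 2 * β ^ 2
            = (η / 3 * Real.log (β / 2) + K₁) * (h ^ 2 * β ^ 2) := by ring
          _ ≤ (η / 3 * Real.log β + K₁) * (h ^ 2 * β ^ 2) := hmono
          _ = (η / 3 * Real.log β + K₁) * h ^ 2 * β ^ 2 := by ring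
          _ ≤ η / 3 * Real.log β + K₁ := e1
      -- the pressures enter only now
      set P : ℝ → ℝ → ℝ → ℝ := fun b u s =>
        Real.log (partitionFn b (dWaveSourceTorus L u μ s)).re / (b * (L : ℝ) ^ 2) with hPdef
      have d1 := hLA L hLA' h hhA
      have d2 := hLA2 L hLA2' h hhA2
      have b1 := hLB L hLB'
      change |(P β U h - P β 0 h) - (P β U 0 - P β 0 0)| ≤ (η / 3 * Real.log β + K₁) * h ^ 2 at d1
      change |(P (β / 2) U h - P (β / 2) 0 h) - (P (β / 2) U 0 - P (β / 2) 0 0)| ≤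
        (η / 3 * Real.log (β / 2) + K₁) * h ^ 2 at d2
      change (P (β / 2) U 0 - P β U 0) - (P (β / 2) 0 0 - P β 0 0) ≤
        (η / 3 * Real.log β + K₂) / β ^ 2 at b1
      change (P (β / 2) U h - P β U h) - (P (β / 2) 0 h - P β 0 h) ≤
        (η * Real.log β + (K₂ + 2 * K₁ + 8 * U₁)) / β ^ 2
      rw [abs_le] at d1 d2
      rw [le_div_iff₀ hβsq] at b1 ⊢
      have hLHS : (P (β / 2) U h - P β U h) - (P (β / 2) 0 h - P β 0 h) ≤
          ((P (β / 2) U 0 - P β U 0) - (P (β / 2) 0 0 - P β 0 0)) +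
            (η / 3 * Real.log (β / 2) + K₁) * h ^ 2 + (η / 3 * Real.log β + K₁) * h ^ 2 := by
        linarith only [d1.1, d2.2]
      have hmul := mul_le_mul_of_nonneg_right hLHS hβsq.le
      have hU8 : 0 ≤ 8 * U₁ := by linarith only [hU₁]
      linarith only [hmul, b1, e1, e2, hU8]
    · -- warm temperatures 1 ≤ β < 2: the crude sandwich suffices, no threshold needed
      push Not at hβ2
      refine ⟨0, fun L _ _ h hh => ?_⟩
      set P : ℝ → ℝ → ℝ → ℝ := fun b u s =>
        Real.log (partitionFn b (dWaveSourceTorus L u μ s)).re / (b * (L : ℝ) ^ 2) with hPdef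
      have c1 := abs_sourcedPressure_interacting_sub_free_le L U μ h (half_pos hβpos)
      have c2 := abs_sourcedPressure_interacting_sub_free_le L U μ h hβpos
      change |P (β / 2) U h - P (β / 2) 0 h| ≤ |U| at c1
      change |P β U h - P β 0 h| ≤ |U| at c2
      change (P (β / 2) U h - P β U h) - (P (β / 2) 0 h - P β 0 h) ≤
        (η * Real.log β + (K₂ + 2 * K₁ + 8 * U₁)) / β ^ 2
      rw [abs_of_pos hU] at c1 c2
      rw [abs_le] at c1 c2
      have hlhs : (P (β / 2) U h - P β U h) - (P (β / 2) 0 h - P β 0 h) ≤ 2 * U := by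
        linarith only [c1.2, c2.1]
      have hβsq4 : β ^ 2 ≤ 4 := by
        have := pow_le_pow_left₀ hβpos.le hβ2.le 2
        norm_num at this
        exact this
      have h8 : 0 ≤ η * Real.log β := mul_nonneg hη.le hlogβ
      rw [le_div_iff₀ hβsq]
      have step1 : ((P (β / 2) U h - P β U h) - (P (β / 2) 0 h - P β 0 h)) * β ^ 2 ≤
          2 * U * β ^ 2 := mul_le_mul_of_nonneg_right hlhs hβsq.le
      have step2 : 2 * U * β ^ 2 ≤ 2 * U * 4 :=
        mul_le_mul_of_nonneg_left hβsq4 (by linarith only [hU])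
      linarith only [step1, step2, h8, hK₁, hK₂, hUU₁]

/-! ### 2. The crux from the engine statement -/

/-- **`TwSourcedCondensation` from the engine statement `E = (A) ∧ (B)`**: the two-sided disc
slack (A) (`∃ κ ∀ η ∃ U₀ a K`, `|D_L(β,h)| ≤ (η log β + K)h²` on `|h| ≤ κ/β`, `1 ≤ β ≤ e^{a/U}`) and
the zero-source heat-chord slack (B) (`∀ η ∃ U₀ a K'`,
`[chord_U − chord_0](β,0) ≤ (η log β + K')/β²`,
`2 ≤ β ≤ e^{a/U}`) imply the crux, via `discStubs_of_engine` and the entropy staircase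
`twSourcedCondensation_of_discStubs`.
[cite: BenfattoGiulianiMastropietro2006, Thm 1.1 and Remark 2] -/
theorem twSourcedCondensation_of_engine :
    (∀ μ₁ μ₂ : ℝ, -4 < μ₁ → μ₁ ≤ μ₂ → μ₂ < 0 → ∃ κ : ℝ, 0 < κ ∧ ∀ η : ℝ, 0 < η →
      ∃ U₀ a K : ℝ, 0 < U₀ ∧ 0 < a ∧ 0 < K ∧ ∀ U : ℝ, 0 < U → U ≤ U₀ →
      ∀ β : ℝ, 1 ≤ β → β ≤ Real.exp (a / U) → ∀ μ ∈ Set.Icc μ₁ μ₂, ∃ L₀ : ℕ,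
      ∀ (L : ℕ) [NeZero L], L₀ ≤ L → ∀ h : ℝ, |h| ≤ κ / β →
        |(Real.log (Matrix.partitionFn β
            (Literature.MathematicalPhysics.QuantumLattice.dWaveSourceTorus L U μ h)).re /
            (β * (L : ℝ) ^ 2) -
            Real.log (Matrix.partitionFn β
            (Literature.MathematicalPhysics.QuantumLattice.dWaveSourceTorus L 0 μ h)).re /
            (β * (L : ℝ) ^ 2)) -
          (Real.log (Matrix.partitionFn β
            (Literature.MathematicalPhysics.QuantumLattice.dWaveSourceTorus L U μ 0)).re /
            (β * (L : ℝ) ^ 2) -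
            Real.log (Matrix.partitionFn β
            (Literature.MathematicalPhysics.QuantumLattice.dWaveSourceTorus L 0 μ 0)).re /
            (β * (L : ℝ) ^ 2))| ≤
        (η * Real.log β + K) * h ^ 2) →
    (∀ μ₁ μ₂ : ℝ, -4 < μ₁ → μ₁ ≤ μ₂ → μ₂ < 0 → ∀ η : ℝ, 0 < η →
      ∃ U₀ a K' : ℝ, 0 < U₀ ∧ 0 < a ∧ 0 < K' ∧ ∀ U : ℝ, 0 < U → U ≤ U₀ →
      ∀ β : ℝ, 2 ≤ β → β ≤ Real.exp (a / U) → ∀ μ ∈ Set.Icc μ₁ μ₂, ∃ L₀ : ℕ,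
      ∀ (L : ℕ) [NeZero L], L₀ ≤ L →
        (Real.log (Matrix.partitionFn (β / 2)
            (Literature.MathematicalPhysics.QuantumLattice.dWaveSourceTorus L U μ 0)).re /
            (β / 2 * (L : ℝ) ^ 2) -
            Real.log (Matrix.partitionFn β
            (Literature.MathematicalPhysics.QuantumLattice.dWaveSourceTorus L U μ 0)).re /
            (β * (L : ℝ) ^ 2)) -
          (Real.log (Matrix.partitionFn (β / 2)
            (Literature.MathematicalPhysics.QuantumLattice.dWaveSourceTorus L 0 μ 0)).re /
            (β / 2 * (L : ℝ) ^ 2) -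
            Real.log (Matrix.partitionFn β
            (Literature.MathematicalPhysics.QuantumLattice.dWaveSourceTorus L 0 μ 0)).re /
            (β * (L : ℝ) ^ 2)) ≤
        (η * Real.log β + K') / β ^ 2) →
    Summit.HubbardSuperconductivity.HubbardSuperconductivity.Theses.ThermalWedge.TwSourcedCondensation :=
  fun hA hB => twSourcedCondensation_of_discStubs (discStubs_of_engine hA hB)

/-! ### 3. The sister crux from the same engine statement -/

/-- **`TwSourcedInertness` from the engine statement `E = (A) ∧ (B)`**: the upper half of (A)
with `η = 1` is hypothesis (D) of `twSourcedInertness_of_corrections` (`C = 1 + K`, `c = κ`), and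
(B) with `η = 1` is its hypothesis (T) (`C = 1 + K'`;
`dWaveSourceTorus L U μ 0 = hubbardTorusWith 2 L 1 U μ`).
[cite: BenfattoGiulianiMastropietro2006, Thm 1.1 and Remark 2] -/
theorem twSourcedInertness_of_engine :
    (∀ μ₁ μ₂ : ℝ, -4 < μ₁ → μ₁ ≤ μ₂ → μ₂ < 0 → ∃ κ : ℝ, 0 < κ ∧ ∀ η : ℝ, 0 < η →
      ∃ U₀ a K : ℝ, 0 < U₀ ∧ 0 < a ∧ 0 < K ∧ ∀ U : ℝ, 0 < U → U ≤ U₀ →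
      ∀ β : ℝ, 1 ≤ β → β ≤ Real.exp (a / U) → ∀ μ ∈ Set.Icc μ₁ μ₂, ∃ L₀ : ℕ,
      ∀ (L : ℕ) [NeZero L], L₀ ≤ L → ∀ h : ℝ, |h| ≤ κ / β →
        |(Real.log (Matrix.partitionFn β
            (Literature.MathematicalPhysics.QuantumLattice.dWaveSourceTorus L U μ h)).re /
            (β * (L : ℝ) ^ 2) -
            Real.log (Matrix.partitionFn β
            (Literature.MathematicalPhysics.QuantumLattice.dWaveSourceTorus L 0 μ h)).re /
            (β * (L : ℝ) ^ 2)) -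
          (Real.log (Matrix.partitionFn β
            (Literature.MathematicalPhysics.QuantumLattice.dWaveSourceTorus L U μ 0)).re /
            (β * (L : ℝ) ^ 2) -
            Real.log (Matrix.partitionFn β
            (Literature.MathematicalPhysics.QuantumLattice.dWaveSourceTorus L 0 μ 0)).re /
            (β * (L : ℝ) ^ 2))| ≤
        (η * Real.log β + K) * h ^ 2) →
    (∀ μ₁ μ₂ : ℝ, -4 < μ₁ → μ₁ ≤ μ₂ → μ₂ < 0 → ∀ η : ℝ, 0 < η →
      ∃ U₀ a K' : ℝ, 0 < U₀ ∧ 0 < a ∧ 0 < K' ∧ ∀ U : ℝ, 0 < U → U ≤ U₀ →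
      ∀ β : ℝ, 2 ≤ β → β ≤ Real.exp (a / U) → ∀ μ ∈ Set.Icc μ₁ μ₂, ∃ L₀ : ℕ,
      ∀ (L : ℕ) [NeZero L], L₀ ≤ L →
        (Real.log (Matrix.partitionFn (β / 2)
            (Literature.MathematicalPhysics.QuantumLattice.dWaveSourceTorus L U μ 0)).re /
            (β / 2 * (L : ℝ) ^ 2) -
            Real.log (Matrix.partitionFn β
            (Literature.MathematicalPhysics.QuantumLattice.dWaveSourceTorus L U μ 0)).re /
            (β * (L : ℝ) ^ 2)) -
          (Real.log (Matrix.partitionFn (β / 2)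
            (Literature.MathematicalPhysics.QuantumLattice.dWaveSourceTorus L 0 μ 0)).re /
            (β / 2 * (L : ℝ) ^ 2) -
            Real.log (Matrix.partitionFn β
            (Literature.MathematicalPhysics.QuantumLattice.dWaveSourceTorus L 0 μ 0)).re /
            (β * (L : ℝ) ^ 2)) ≤
        (η * Real.log β + K') / β ^ 2) →
    Summit.HubbardSuperconductivity.HubbardSuperconductivity.Theses.ThermalWedge.TwSourcedInertness := by
  intro hA hB
  refine twSourcedInertness_of_corrections ?_ ?_
  · -- (D) from the upper half of (A) at η = 1
    intro μ₁ μ₂ h4 h12 h0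
    obtain ⟨κ, hκ, hAη⟩ := hA μ₁ μ₂ h4 h12 h0
    obtain ⟨U₀, a, K, hU₀, ha, hK, hmain⟩ := hAη 1 one_pos
    refine ⟨U₀, a, 1 + K, κ, hU₀, ha, by positivity, hκ, fun U hU hUU₀ β hβ hβa μ hμ => ?_⟩
    obtain ⟨L₀, hL₀⟩ := hmain U hU hUU₀ β hβ hβa μ hμ
    refine ⟨L₀, fun L _ hL h hh => ?_⟩
    have key := hL₀ L hL h hh
    rw [abs_le] at key
    have hsq : 0 ≤ h ^ 2 := sq_nonneg h
    have hlogβ : 0 ≤ Real.log β := Real.log_nonneg hβ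
    have hKl : 0 ≤ K * Real.log β := mul_nonneg hK.le hlogβ
    have e : (1 * Real.log β + K) * h ^ 2 ≤ (1 + K) * (1 + Real.log β) * h ^ 2 :=
      mul_le_mul_of_nonneg_right (by linarith only [hKl]) hsq
    exact key.2.trans e
  · -- (T) from (B) at η = 1
    intro μ₁ μ₂ h4 h12 h0
    obtain ⟨U₀, a, K', hU₀, ha, hK', hmain⟩ := hB μ₁ μ₂ h4 h12 h0 1 one_pos
    refine ⟨U₀, a, 1 + K', hU₀, ha, by positivity, fun U hU hUU₀ β hβ hβa μ hμ => ?_⟩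
    obtain ⟨L₀, hL₀⟩ := hmain U hU hUU₀ β hβ hβa μ hμ
    refine ⟨L₀, fun L _ hL => ?_⟩
    have key := hL₀ L hL
    simp only [dWaveSourceTorus_zero] at key
    have hβpos : 0 < β := by linarith
    have hβsq : 0 < β ^ 2 := by positivity
    have hlogβ : 0 ≤ Real.log β := Real.log_nonneg (by linarith)
    have hKl : 0 ≤ K' * Real.log β := mul_nonneg hK'.le hlogβ
    have e : (1 * Real.log β + K') / β ^ 2 ≤ (1 + K') * (1 + Real.log β) / β ^ 2 :=
      div_le_div_of_nonneg_right (by linarith only [hKl]) hβsq.le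
    exact key.trans e

end Summit.HubbardSuperconductivity.HubbardSuperconductivity.Theorems
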